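import Literature.NumberTheory.GelbartRogawski1991.LocalDoubledUnitaryBigCellValue
import Literature.GroupTheory.GroupChunkExtension
import HarnessLib

-- buildfix G11b-3 recipe (LEDGER B13-1/B13-3): elaborate sequentially so the trailing `attribute [implicit_reducible]`
-- block (reducibilityCoreExt is keyed to the async environment branch) is in force at `.olean` export.
set_option Elab.async false

/-!
# Kudla's splitting function on the big cell of the doubled unitary group at a non-split place
# ([Kudla1994, §3, Thm 3.1]; [HarrisKudlaSweet1996, §1 (1.14)–(1.19)])

Topic `NumberTheory/GelbartRogawski1991`; namespace
`Literature.NumberTheory.GelbartRogawski1991.UnitaryDualPair.LocalSplitting` (sequel of `LocalDoubledUnitaryBigCellValue`).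
KERNEL only: one auxiliary definition (`chiS`) and proved theorems; no named fact, no `sorry`.

Let `v` be a finite place of `F` that does not split in `E`, `w` the place above it, `χ_w : E_wˣ → ℂˣ` a character whose
restriction to `F_vˣ` is the quadratic character `a ↦ (d, a)_v` of `E_w/F_v` (hypothesis `hχ`, [Kudla1994, (3.1)]:
`χ|_{F×} = ε_{E/F}`).  From the value `c^{ψ'}_{ℓ_Δ}(ι a, ι b) = (d, det H(a, b))_v γ⁰ⁿ` of the prequel and
`det H(a, b) = const · σ(det C_b · det(C_{ab}⁻¹) · det C_a)`:

* §1 `χ_w` on units of `E ⊗ F_v` (`chiS`), `χ_w(ι_v a) = (d, a)_v` and the NORM RELATION `χ_w(σ x) χ_w(x) = 1`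
  (`(d, N x)_v = 1`, tree `hilbertSymbol_norm_eq_one`);
* §2 **THE MULTIPLIER IDENTITY ON THE BIG CELL** (`localLeray_val_mul_chi`): for `a, b, ab ∈ Ω_H`,
  `c^{ψ'}(ι a, ι b) · χ_w(det C_a) · χ_w(det C_b) = κ · χ_w(det C_{ab})` with the CONSTANT
  `κ = γ⁰ⁿ · χ_w(((2 d⁻¹δ)ⁿ (−1)ⁿ) · det(T₀ ⊗ 1))`;
* §3 hence Kudla's function `φ(g) = κ · χ_w(det C_g)⁻¹` has multiplier `c^{ψ'}_{ℓ_Δ} ∘ ι` on `Ω_H` in the sense of the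
  tree's group-chunk machinery (`HasMultiplierOn`) and is right `P_Δ`-equivariant,
  `φ(x p) = φ(x) · χ_v(det_Δ p)` for the inverse character (`exists_kudla_bigCell_function`, stated for the datum
  `χ_v⁻¹` so that the `P_Δ`-values are `χ_v(det_Δ p)` as consumed by [GelbartRogawski1991, §3.1]).

## References

* S. S. Kudla, Israel J. Math. 87 (1994) 361–401, §3 and Thm 3.1 [Kudla1994].
* M. Harris, S. S. Kudla, W. J. Sweet, J. Amer. Math. Soc. 9 (1996) 941–1004, §1 (1.14)–(1.19) [HarrisKudlaSweet1996].
* A. Weil, Acta Math. 111 (1964), n° 42–43 [Weil1964].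
-/

set_option autoImplicit false

noncomputable section

open NumberField IsDedekindDomain MeasureTheory Matrix
open Literature.RepresentationTheory.HeisenbergGroup
open Literature.NumberTheory.Automorphic Literature.NumberTheory.Automorphic.UnitaryGroup
open Literature.NumberTheory.Automorphic.UnitaryGroup.QuadraticCoordinates
open Literature.NumberTheory.GelbartRogawski1991.AdaptedBlocks
open Literature.NumberTheory.Weil1964
open Literature.NumberTheory.GaloisRepresentations.IsNonarchimedeanLocalField
open Literature.NumberTheory.QuadraticForms
open Literature.LinearAlgebra.QuadraticForm Literature.GroupTheory

namespace Literature.NumberTheory.GelbartRogawski1991.UnitaryDualPair.LocalSplitting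

variable (F : Type) [Field F] [NumberField F] (E : Type) [Field E] [NumberField E] [Algebra F E]
  (c : E ≃ₐ[F] E)
  {δ : E} (hcδ : c δ = -δ) (hδ : δ ≠ 0) {d : F} (hd : δ * δ = algebraMap F E d)
  (v : HeightOneSpectrum (𝓞 F)) (n : ℕ) {T₀ : Matrix (Fin n) (Fin n) F} (hT₀ : T₀.IsSymm) (hT₀d : IsUnit T₀.det)
  {JD : Matrix (Fin (n + n)) (Fin (n + n)) E} (hJD : JD = (gramD F n T₀).map (algebraMap F E))
  (w : PlacesOver E v)

/-! ## §1 `χ_w` on units of `E ⊗ F_v` and the norm relation -/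

/-- `χ_w` read on the units of `E ⊗ F_v = Π_{w' ∣ v} E_{w'}` through the `w`-component. [cite: Kudla1994, §3 (3.1)] -/
def chiS (χw : (w.1.adicCompletion E)ˣ →* ℂˣ) : (LocalRing E v)ˣ →* ℂˣ :=
  χw.comp (Units.map (Pi.evalRingHom (fun w' : PlacesOver E v => w'.1.adicCompletion E) w).toMonoidHom)

omit [NumberField F] in
/-- unfolding: `chiS χ_w u = χ_w (u_w)`. [cite: Kudla1994, §3 (3.1)] -/
theorem chiS_apply (χw : (w.1.adicCompletion E)ˣ →* ℂˣ) (u : (LocalRing E v)ˣ) :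
    chiS F E v w χw u = χw (Units.map (Pi.evalRingHom (fun w' : PlacesOver E v => w'.1.adicCompletion E) w).toMonoidHom u) :=
  rfl

omit [NumberField F] in
/-- the value of `chiS` depends only on the underlying element. [cite: Kudla1994, §3 (3.1)] -/
theorem chiS_congr (χw : (w.1.adicCompletion E)ˣ →* ℂˣ) {x y : LocalRing E v} (hx : IsUnit x) (hy : IsUnit y)
    (h : x = y) : chiS F E v w χw hx.unit = chiS F E v w χw hy.unit := by
  subst h; rfl

/-- **`χ_w(ι_v a) = (d, a)_v`** on `F_vˣ` — the hypothesis `χ|_{F_vˣ} = ε_{E_w/F_v}` read through `chiS`.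
[cite: Kudla1994, §3 (3.1); HarrisKudlaSweet1996, §1 (1.15)] -/
theorem chiS_toLocalRing (χw : (w.1.adicCompletion E)ˣ →* ℂˣ)
    (hχ : ∀ a : (v.adicCompletion F)ˣ, ((χw (Units.map (toPlace v w : v.adicCompletion F →* w.1.adicCompletion E) a)
      : ℂˣ) : ℂ) = hilbertSymbol (v.adicCompletion F) (d : v.adicCompletion F) a)
    {t : v.adicCompletion F} (ht : IsUnit (toLocalRing E v t)) (ht0 : t ≠ 0) :
    ((chiS F E v w χw ht.unit : ℂˣ) : ℂ) = hilbertSymbol (v.adicCompletion F) (d : v.adicCompletion F) t := by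
  have h := hχ (Units.mk0 t ht0)
  rw [Units.val_mk0] at h
  rw [← h, chiS_apply]
  congr 2
  ext
  rfl

section Norm

variable [Algebra.IsQuadraticExtension F E]

include hcδ hδ hd in
/-- **the norm form on `E ⊗ F_v`**: `x · σ(x) = ι_v(re x² − d · im x²)`. [cite: HarrisKudlaSweet1996, §1 (1.16)] -/
theorem mul_conjLocal_eq (x : LocalRing E v) :
    x * conjLocal E c v x =
      toLocalRing E v (re (quadraticLocalEquiv E v c hcδ hδ).toLinearEquiv.toAddEquiv x ^ 2 -
        (d : v.adicCompletion F) * im (quadraticLocalEquiv E v c hcδ hδ).toLinearEquiv.toAddEquiv x ^ 2) := by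
  have h := isQuadraticCoordinates_local E v c hcδ hδ hd
  set Ψ := (quadraticLocalEquiv E v c hcδ hδ).toLinearEquiv.toAddEquiv
  conv_lhs => rw [← h.re_add_im x]
  rw [map_add, _root_.map_mul, conjLocal_toLocalRing, conjLocal_toLocalRing, conjLocal_algebraMap, hcδ, map_neg,
    map_sub, map_pow, _root_.map_mul, map_pow]
  have hδδ : algebraMap E (LocalRing E v) δ * algebraMap E (LocalRing E v) δ = toLocalRing E v (d : v.adicCompletion F) :=
    h.mul_self
  linear_combination (-(toLocalRing E v (im Ψ x)) ^ 2) * hδδ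

include hcδ hδ hd in
/-- a `σ`-invariant element of `E ⊗ F_v` is `ι_v` of its real part. [cite: HarrisKudlaSweet1996, §1 (1.16)] -/
theorem eq_toLocalRing_re_of_conj_eq {x : LocalRing E v} (hx : conjLocal E c v x = x) :
    x = toLocalRing E v (re (quadraticLocalEquiv E v c hcδ hδ).toLinearEquiv.toAddEquiv x) := by
  have h := isQuadraticCoordinates_local E v c hcδ hδ hd
  haveI : CharZero (v.adicCompletion F) := charZero_of_injective_algebraMap (algebraMap F _).injective
  have him : im (quadraticLocalEquiv E v c hcδ hδ).toLinearEquiv.toAddEquiv x = 0 := by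
    have e := h.im_conj (σ := conjLocal E c v) (conjLocal_toLocalRing c v) (by rw [conjLocal_algebraMap, hcδ, map_neg]) x
    rw [hx] at e
    have e2 : (2 : v.adicCompletion F) * im (quadraticLocalEquiv E v c hcδ hδ).toLinearEquiv.toAddEquiv x = 0 := by
      linear_combination e
    exact (mul_eq_zero.1 e2).resolve_left two_ne_zero
  conv_lhs => rw [← h.re_add_im x, him, map_zero, zero_mul, add_zero]

include hcδ hδ hd in
/-- **the norm relation**: `χ_w(σ x) · χ_w(x) = (d, N x)_v = 1` for a unit `x` of `E ⊗ F_v` (norms are killed by the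
quadratic character; tree `hilbertSymbol_norm_eq_one`). [cite: Kudla1994, §3; HarrisKudlaSweet1996, §1 (1.15)] -/
theorem chiS_conj_mul_chiS (χw : (w.1.adicCompletion E)ˣ →* ℂˣ)
    (hχ : ∀ a : (v.adicCompletion F)ˣ, ((χw (Units.map (toPlace v w : v.adicCompletion F →* w.1.adicCompletion E) a)
      : ℂˣ) : ℂ) = hilbertSymbol (v.adicCompletion F) (d : v.adicCompletion F) a)
    {x : LocalRing E v} (hx : IsUnit x) :
    ((chiS F E v w χw (hx.map (conjLocal E c v)).unit : ℂˣ) : ℂ) * ((chiS F E v w χw hx.unit : ℂˣ) : ℂ) = 1 := by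
  haveI : CharZero (v.adicCompletion F) := charZero_of_injective_algebraMap (algebraMap F _).injective
  have h := isQuadraticCoordinates_local E v c hcδ hδ hd
  set Ψ := (quadraticLocalEquiv E v c hcδ hδ).toLinearEquiv.toAddEquiv
  set t : v.adicCompletion F := re Ψ x ^ 2 - (d : v.adicCompletion F) * im Ψ x ^ 2 with ht
  have hxx : conjLocal E c v x * x = toLocalRing E v t := by rw [mul_comm, mul_conjLocal_eq F E c hcδ hδ hd v x]
  have htu : IsUnit (toLocalRing E v t) := by rw [← hxx]; exact (hx.map _).mul hx
  have ht0 : t ≠ 0 := by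
    intro h0; rw [h0, map_zero] at htu; exact not_isUnit_zero htu
  have hst : re Ψ x ≠ 0 ∨ im Ψ x ≠ 0 := by
    by_contra hcon
    rw [not_or, not_not, not_not] at hcon
    apply hx.ne_zero
    rw [← h.re_add_im x, hcon.1, hcon.2, map_zero, zero_mul, add_zero]
  rw [← Units.val_mul, ← MonoidHom.map_mul, ← IsUnit.unit_mul, chiS_congr F E v w χw _ htu hxx,
    chiS_toLocalRing F E v w χw hχ htu ht0, ht, hilbertSymbol_norm_eq_one two_ne_zero (coe_d_ne_zero F E hδ hd v) hst,
    Int.cast_one]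

end Norm

/-! ## §2 The multiplier identity on the big cell -/

section Multiplier

variable [Algebra.IsQuadraticExtension F E]

include hcδ hδ hd hT₀ hJD in
/-- `det H(a, b)` is `σ`-invariant (a hermitian matrix). [cite: HarrisKudlaSweet1996, §1 (1.16)] -/
theorem conj_det_transverseHerm (a b : UnitaryGroup.localPi E c (n + n) JD v)
    (hab : IsUnit (blkC (matA F E c v n (a * b)))) :
    conjLocal E c v (transverseHerm F E c v n δ d T₀ a b).det = (transverseHerm F E c v n δ d T₀ a b).det := by
  rw [RingHom.map_det, RingHom.mapMatrix_apply]
  have : (transverseHerm F E c v n δ d T₀ a b).map (conjLocal E c v) = (transverseHerm F E c v n δ d T₀ a b)ᵀ := by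
    ext i j
    rw [Matrix.map_apply, Matrix.transpose_apply, transverseHerm_conj F E c hcδ hδ hd v n hT₀ hJD a b hab]
  rw [this, Matrix.det_transpose]

variable [MeasurableSpace (HeightOneSpectrum.adicCompletion F v)] [BorelSpace (HeightOneSpectrum.adicCompletion F v)]
  (μ : Measure (HeightOneSpectrum.adicCompletion F v)) [μ.IsAddHaarMeasure]

include hT₀ in
/-- **THE MULTIPLIER IDENTITY ON THE BIG CELL** ([Kudla1994, Thm 3.1] at a non-split place, big-cell part): for
`a, b, ab ∈ Ω_H`,
`c^{ψ'}_{ℓ_Δ}(ι a, ι b) · χ_w(det C_a) · χ_w(det C_b) = γ⁰ⁿ · χ_w(((2d⁻¹δ)ⁿ(−1)ⁿ) det(T₀ ⊗ 1)) · χ_w(det C_{ab})`.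
[cite: Kudla1994, Thm 3.1; HarrisKudlaSweet1996, §1 (1.14)–(1.16)] -/
theorem localLeray_val_mul_chi {ψ' : AddChar (v.adicCompletion F) Circle} (hψ' : ψ'.IsContinuousNontrivial)
    (hw : c • w.1 = w.1) (χw : (w.1.adicCompletion E)ˣ →* ℂˣ)
    (hχ : ∀ a : (v.adicCompletion F)ˣ, ((χw (Units.map (toPlace v w : v.adicCompletion F →* w.1.adicCompletion E) a)
      : ℂˣ) : ℂ) = hilbertSymbol (v.adicCompletion F) (d : v.adicCompletion F) a)
    (a b : UnitaryGroup.localPi E c (n + n) JD v)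
    (ha : IsUnit (blkC (matA F E c v n a)).det) (hb : IsUnit (blkC (matA F E c v n b)).det)
    (hab : IsUnit (blkC (matA F E c v n (a * b))).det)
    (hK : IsUnit ((deltaInv F E v δ d * 2) ^ n * (-1) ^ n * (gramS F E v n T₀).det)) :
    ((localLeray F (n + n) (gramD F n T₀) (isUnit_det_gramD F n hT₀d) v μ ψ' hψ' (deltaLagrangian F v n)
        (deltaLagrangian_orthogonal F v n T₀ hT₀d) (iotaD F E c hcδ hδ hd v n hT₀ hJD a)
        (iotaD F E c hcδ hδ hd v n hT₀ hJD b) : ℂˣ) : ℂ) *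
        (chiS F E v w χw ha.unit : ℂ) * (chiS F E v w χw hb.unit : ℂ) =
      normFormIndex F v ψ' μ (d : v.adicCompletion F) ^ n * (chiS F E v w χw hK.unit : ℂ) *
        (chiS F E v w χw hab.unit : ℂ) := by
  have ha' : IsUnit (blkC (matA F E c v n a)) := (Matrix.isUnit_iff_isUnit_det _).2 ha
  have hb' : IsUnit (blkC (matA F E c v n b)) := (Matrix.isUnit_iff_isUnit_det _).2 hb
  have hab' : IsUnit (blkC (matA F E c v n (a * b))) := (Matrix.isUnit_iff_isUnit_det _).2 hab
  set Ψ := (quadraticLocalEquiv E v c hcδ hδ).toLinearEquiv.toAddEquiv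
  -- the determinant and its pieces
  have hinv : IsUnit ((blkC (matA F E c v n (a * b)))⁻¹).det :=
    IsUnit.of_mul_eq_one _ (Matrix.det_nonsing_inv_mul_det _ hab)
  have hX : IsUnit ((blkC (matA F E c v n b)).det * ((blkC (matA F E c v n (a * b)))⁻¹).det *
      (blkC (matA F E c v n a)).det) := (hb.mul hinv).mul ha
  have hσX := hX.map (conjLocal E c v)
  have hHu : IsUnit (transverseHerm F E c v n δ d T₀ a b).det :=
    isUnit_det_transverseHerm F E c hδ hd v n hT₀d hJD a b ha' hb' hab'
  -- `det H = ι_v (re det H)` and the Hilbert symbol as a `χ`-value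
  have hre : (transverseHerm F E c v n δ d T₀ a b).det = toLocalRing E v (re Ψ (transverseHerm F E c v n δ d T₀ a b).det) :=
    eq_toLocalRing_re_of_conj_eq F E c hcδ hδ hd v (conj_det_transverseHerm F E c hcδ hδ hd v n hT₀ hJD a b hab')
  have htu : IsUnit (toLocalRing E v (re Ψ (transverseHerm F E c v n δ d T₀ a b).det)) := by rwa [← hre]
  have ht0 : re Ψ (transverseHerm F E c v n δ d T₀ a b).det ≠ 0 := by
    intro h0; rw [h0, map_zero] at htu; exact not_isUnit_zero htu
  -- the units `K₁ = (2d⁻¹δ)ⁿ(−1)ⁿ`, `T' = det (T₀ ⊗ 1)` and the factorisations `det H = K₁ σ(X) T'`, `K = K₁ T'`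
  have hT : IsUnit (gramS F E v n T₀).det := by
    rw [gramS, ← RingHom.mapMatrix_apply, ← RingHom.mapMatrix_apply, ← RingHom.map_det, ← RingHom.map_det]
    exact (hT₀d.map _).map _
  have hK₁ : IsUnit ((deltaInv F E v δ d * 2) ^ n * (-1 : LocalRing E v) ^ n) := by
    have hd0 : (d : v.adicCompletion F) ≠ 0 := coe_d_ne_zero F E hδ hd v
    have hδu : IsUnit (deltaInv F E v δ d) := by
      rw [deltaInv]
      exact ((IsUnit.mk0 _ (inv_ne_zero hd0)).map _).mul ((IsUnit.mk0 δ hδ).map _)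
    exact ((hδu.mul (isUnit_of_invertible 2)).pow n).mul ((isUnit_one.neg).pow n)
  have e_detH : hHu.unit = hK₁.unit * hσX.unit * hT.unit := Units.ext (by
    simp only [Units.val_mul, IsUnit.unit_spec]
    exact det_transverseHerm F E c v n hJD a b hab')
  have e_K : hK.unit = hK₁.unit * hT.unit := Units.ext (by simp only [Units.val_mul, IsUnit.unit_spec])
  have e_X : hX.unit = hb.unit * hinv.unit * ha.unit := Units.ext (by simp only [Units.val_mul, IsUnit.unit_spec])
  have e_inv : hinv.unit * hab.unit = 1 := Units.ext (by
    simp only [Units.val_mul, IsUnit.unit_spec, Units.val_one]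
    exact Matrix.det_nonsing_inv_mul_det _ hab)
  -- the relations between the `χ`-values
  have h1 : ((chiS F E v w χw hσX.unit : ℂˣ) : ℂ) * (chiS F E v w χw hX.unit : ℂ) = 1 :=
    chiS_conj_mul_chiS F E c hcδ hδ hd v w χw hχ hX
  have h2 : ((chiS F E v w χw hX.unit : ℂˣ) : ℂ) =
      (chiS F E v w χw hb.unit : ℂ) * (chiS F E v w χw hinv.unit : ℂ) * (chiS F E v w χw ha.unit : ℂ) := by
    rw [e_X, MonoidHom.map_mul (chiS F E v w χw) (hb.unit * hinv.unit) ha.unit,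
      MonoidHom.map_mul (chiS F E v w χw) hb.unit hinv.unit, Units.val_mul, Units.val_mul]
  have h3 : ((chiS F E v w χw hinv.unit : ℂˣ) : ℂ) * (chiS F E v w χw hab.unit : ℂ) = 1 := by
    rw [← Units.val_mul, ← MonoidHom.map_mul, e_inv, _root_.map_one, Units.val_one]
  rw [localLeray_val_eq_hilbertSymbol_mul F E c hcδ hδ hd v n hT₀ hT₀d hJD μ hψ' w hw a b ha' hb' hab',
    ← chiS_toLocalRing F E v w χw hχ htu ht0, ← chiS_congr F E v w χw hHu htu hre, e_detH, e_K,
    MonoidHom.map_mul (chiS F E v w χw) (hK₁.unit * hσX.unit) hT.unit,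
    MonoidHom.map_mul (chiS F E v w χw) hK₁.unit hσX.unit, MonoidHom.map_mul (chiS F E v w χw) hK₁.unit hT.unit,
    Units.val_mul, Units.val_mul, Units.val_mul]
  linear_combination (normFormIndex F v ψ' μ (d : v.adicCompletion F) ^ n *
      ((chiS F E v w χw hK₁.unit : ℂˣ) : ℂ) * ((chiS F E v w χw hT.unit : ℂˣ) : ℂ)) *
    (((chiS F E v w χw hab.unit : ℂˣ) : ℂ) * h1 -
      ((chiS F E v w χw hab.unit : ℂˣ) : ℂ) * ((chiS F E v w χw hσX.unit : ℂˣ) : ℂ) * h2 -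
      ((chiS F E v w χw hσX.unit : ℂˣ) : ℂ) * ((chiS F E v w χw ha.unit : ℂˣ) : ℂ) *
        ((chiS F E v w χw hb.unit : ℂˣ) : ℂ) * h3)

end Multiplier

include hδ hd hT₀d in
/-- the constant `K = (2d⁻¹δ)ⁿ(−1)ⁿ det(T₀ ⊗ 1)` of the multiplier identity is a unit. [cite: Kudla1994, Thm 3.1] -/
theorem isUnit_kudlaConst :
    IsUnit ((deltaInv F E v δ d * 2) ^ n * (-1 : LocalRing E v) ^ n * (gramS F E v n T₀).det) := by
  have hd0 : (d : v.adicCompletion F) ≠ 0 := coe_d_ne_zero F E hδ hd v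
  have hδu : IsUnit (deltaInv F E v δ d) := by
    rw [deltaInv]
    exact ((IsUnit.mk0 _ (inv_ne_zero hd0)).map _).mul ((IsUnit.mk0 δ hδ).map _)
  have hT : IsUnit (gramS F E v n T₀).det := by
    rw [gramS, ← RingHom.mapMatrix_apply, ← RingHom.mapMatrix_apply, ← RingHom.map_det, ← RingHom.map_det]
    exact (hT₀d.map _).map _
  exact (((hδu.mul (isUnit_of_invertible 2)).pow n).mul ((isUnit_one.neg).pow n)).mul hT


/-! ### Build-lane note (ops-buildfix G11b-3 recipe, LEDGER B13-1, 2026-08-21)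
`lean -o` (the hub build lane, never `lean`/the gate check) runs Lean 4.32's library-suggestion indexers
(`Lean.LibrarySuggestions.SymbolFrequency` / `SineQuaNon`, from their `exportEntriesFn`) over the statement of
every local theorem that is not a denied premise; on this family's statements (very large dependent binder
telescopes through the theta-kernel / dual-pair data) that fold runs for tens of minutes to hours and the build
lane kills the job (incident G11b-3, run/shared/lean/ops/buildfix/G11b-3-DOSSIER.md). `isDeniedPremise` skips
`[implicit_reducible]` constants before any fold, and a reducibility status on a *theorem* is inert (Meta never
unfolds `thmInfo`; the kernel ignores the attribute), so the public theorems of this file are tagged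
`[implicit_reducible]` purely to keep them out of that index. Only other effect: they are not offered by
`+suggestions` premise selectors. No statement or proof is changed; superseded if the operator lands a
deny-list form (`HarnessLib.PremiseIndex`). -/
set_option allowUnsafeReducibility true in
attribute [implicit_reducible]
  chiS_apply chiS_congr chiS_toLocalRing mul_conjLocal_eq eq_toLocalRing_re_of_conj_eq
  chiS_conj_mul_chiS conj_det_transverseHerm localLeray_val_mul_chi isUnit_kudlaConst

end Literature.NumberTheory.GelbartRogawski1991.UnitaryDualPair.LocalSplitting

end
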